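import Summits.QuantumFields.GaugeBoot.TiltedLatticeAxisFlip
import Summits.QuantumFields.GaugeBoot.TiltedLinkRPHolonomy
import Summits.QuantumFields.GaugeBoot.TiltedLatticeSymmetry
import HarnessLib

/-!
# The mid-plane (link) reflection of an axis flip: `x_k ↦ 1 - x_k` without a site frame (gauge-boot, L3 negative supplement; bookkeeping)

HONEST FRAMING (cell `pub-gaugeboot`, page 1 of every file): the venture produces certified bounds
on lattice expectations at stated coupling, gauge group, dimension and torus size; NOT a mass gap,
NOT a continuum limit, NOT a string tension; NOT Yang–Mills-summit-bearing (barriers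
`FixedCouplingUltralocality`, `PerturbativeInvisibility`). Pure bookkeeping for the NEGATIVE result
`TiltedBoxEvenMidAxisRPNegative.lean` (the link mirror `x_i ↦ 1 - x_i` along an in-plane axis of the
square tilted box of even side is not of positive type in `d ≥ 3`).

`TiltedLinkRPGeometry.lean` / `TiltedLinkRPHolonomy.lean` develop the Osterwalder–Seiler mid-plane
reflection `θ x = σ x + e_k` (`midReflect`), its action on links (`midLinkMap`, `k`-links reversed),
configurations (`configMidReflect`, reversed links inverted) and plaquettes (`plaqMidReflect`) for a
SITE FRAME `IsSiteFrame e k σ Q h` — the hypothesis under which link RP holds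
(`IsSiteFrame.linkRP_integral_conj_mul_nonneg`). Along an in-plane axis `i` of a tilted box there is
no site frame (`not_isSiteFrame_tiltedBox_inPlane`), but the reflection itself only needs an AXIS
FLIP `IsAxisFlip e k σ` (`TiltedLatticeAxisFlip.lean`: `σ (e k) = -e k`, `σ (e l) = e l`, `σ² = 1`).
This file records, for every axis flip:

* the identity **`configMidReflect_eq_configReflect_translate`**: `Θ_mid U = Θ_site (τ_{e_k} U)` —
  the mid-plane reflection is the site reflection `configReflect` of the configuration translated by
  `e_k` (and `plaqMidReflect p = plaqReflect p + e_k`); so everything below is inherited from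
  `IsAxisFlip.*_configReflect` and `TiltedLatticeSymmetry.lean`;
* involutivity of `midReflect`, `midLinkMap`, `configMidReflect`, `plaqMidReflect`;
* `Re tr ρ((Θ_mid U)_p) = Re tr ρ(U_{plaqMidReflect p})` as a re-indexing lemma for weighted plaquette
  sums (`IsAxisFlip.sum_plaqMidReflect_configMidReflect`), invariance of the action
  (`wilsonAction_configMidReflect`) and of the Wilson measure `μ_β` at every real `β`
  (`integral_comp_configMidReflect_gibbs_complex`). (The pointwise identity, the Haar-measure
  preservation and the real-valued invariance are the landed `IsSiteFrame.*` lemmas when a site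
  frame exists; for a bare axis flip they are the compositions with `translate (e k)` above and are
  not restated.)

So on the square tilted box the in-plane link mirror is a SYMMETRY of `μ_β`; whether it is of
positive type is the subject of `TiltedBoxEvenMidAxisRPNegative.lean`. Everything is `[folklore]`.

References: K. Osterwalder, E. Seiler, Ann. Phys. 110 (1978) 440, §2; E. Seiler, LNP 159 (1982);
V. Kazakov, Z. Zheng, arXiv:2203.11360 §3.1 (the link-plane RP family of the bootstrap).
-/

noncomputable section

open MeasureTheory
open Literature.MathematicalPhysics.QuantumFieldTheory (haarProbability)
open Literature.RepresentationTheory.CompactGroups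

namespace Summit.QuantumFields.GaugeBoot

namespace TiltedRP

open IsSiteFrame (plaqReflect plaqReflect_fst_of_hasDir plaqReflect_fst_of_not_hasDir plaqReflect_snd)

variable {A : Type*} [AddCommGroup A] {d : ℕ}

/-! ## The mid-plane reflection is the site reflection of the translated configuration -/

/-- **`Θ_mid U = Θ_site (τ_{e_k} U)`**: the mid-plane reflection of configurations attached to
`(e, k, σ)` is the site reflection `configReflect e k σ` of the configuration translated by `e k`
(`translate (e k) U (x, l) = U (x + e_k, l)`). Holds for every additive `σ`. [folklore] -/
theorem configMidReflect_eq_configReflect_translate {G : Type*} [Group G] (e : Fin d → A) (k : Fin d)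
    (σ : A →+ A) (U : Config A d G) :
    configMidReflect e k σ U = configReflect e k σ (translate (e k) U) := by
  funext l
  obtain ⟨x, m⟩ := l
  by_cases hm : m = k
  · subst hm
    rw [configMidReflect_self, configReflect_self, translate_apply]
    simp only [sub_add_cancel]
  · rw [configMidReflect_other e k σ U x hm, configReflect_other e k σ _ x hm, translate_apply]
    rfl

/-- `plaqMidReflect p = plaqReflect p + e_k` (same directions) — stated in the shape produced by
`plaqObs_translate`, so that `Re tr ρ((Θ_mid U)_p) = Re tr ρ(U_{plaqMidReflect p})` is, for an axis
flip, the three rewrites `configMidReflect_eq_configReflect_translate`,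
`IsAxisFlip.plaqObs_configReflect`, `plaqObs_translate` followed by this lemma (the landed
`IsSiteFrame.plaqObs_configMidReflect` needs a site frame). [folklore] -/
theorem plaqMidReflect_eq_plaqReflect_add (e : Fin d → A) (k : Fin d) (σ : A →+ A) (p : Plaq A d) :
    plaqMidReflect e k σ p = ((plaqReflect e k σ p).1 + e k, (plaqReflect e k σ p).2) := by
  by_cases hp : HasDir p k
  · exact Prod.ext (by rw [plaqMidReflect_fst_of_hasDir hp, plaqReflect_fst_of_hasDir hp, sub_add_cancel])
      (plaqMidReflect_snd p)
  · exact Prod.ext (by rw [plaqMidReflect_fst_of_not_hasDir hp, plaqReflect_fst_of_not_hasDir hp]; rfl)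
      (plaqMidReflect_snd p)

namespace IsAxisFlip

variable {e : Fin d → A} {k : Fin d} {σ : A →+ A}
variable (hF : IsAxisFlip e k σ)
include hF

/-! ## The reflection of sites, links, configurations and plaquettes is an involution -/

/-- `θ (x + e k) = σ x`. [folklore] -/
theorem midReflect_add_self (x : A) : midReflect e k σ (x + e k) = σ x := by
  rw [midReflect, hF.map_add_self, sub_add_cancel]

/-- `θ (x + e l) = θ x + e l` for `l ≠ k`. [folklore] -/
theorem midReflect_add_other (x : A) {l : Fin d} (hl : l ≠ k) :
    midReflect e k σ (x + e l) = midReflect e k σ x + e l := by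
  rw [midReflect, midReflect, hF.map_add_other x hl, add_right_comm]

/-- `θ (σ x) = x + e k`. [folklore] -/
theorem midReflect_map (x : A) : midReflect e k σ (σ x) = x + e k := by
  rw [midReflect, hF.invol]

/-- `σ (θ x) = x - e k`. [folklore] -/
theorem map_midReflect (x : A) : σ (midReflect e k σ x) = x - e k := by
  unfold midReflect
  rw [map_add, hF.invol, hF.map_e_self, ← sub_eq_add_neg]

/-- **The mid-plane reflection of an axis flip is an involution.** [folklore] -/
@[simp] theorem midReflect_midReflect (x : A) : midReflect e k σ (midReflect e k σ x) = x := by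
  unfold midReflect
  rw [map_add, hF.invol, hF.map_e_self, neg_add_cancel_right]

/-- `midLinkMap` is an involution. [folklore] -/
@[simp] theorem midLinkMap_midLinkMap (l : Link A d) :
    midLinkMap e k σ (midLinkMap e k σ l) = l := by
  obtain ⟨x, m⟩ := l
  by_cases hm : m = k
  · subst hm
    rw [midLinkMap_self, midLinkMap_self, hF.invol]
  · rw [midLinkMap_other e k σ x hm, midLinkMap_other e k σ _ hm, hF.midReflect_midReflect]

/-- `midLinkMap` is involutive. [folklore] -/
theorem midLinkMap_involutive : Function.Involutive (midLinkMap (d := d) e k σ) :=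
  hF.midLinkMap_midLinkMap

/-- `configMidReflect` is an involution. [folklore] -/
theorem configMidReflect_configMidReflect {G : Type*} [Group G] (U : Config A d G) :
    configMidReflect e k σ (configMidReflect e k σ U) = U := by
  funext l
  obtain ⟨x, m⟩ := l
  by_cases hm : m = k
  · subst hm
    rw [configMidReflect_self, configMidReflect_self, hF.invol, inv_inv]
  · rw [configMidReflect_other e k σ _ x hm, configMidReflect_other e k σ U _ hm,
      hF.midReflect_midReflect]

/-- `plaqMidReflect` is an involution. [folklore] -/
@[simp] theorem plaqMidReflect_plaqMidReflect (p : Plaq A d) :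
    plaqMidReflect e k σ (plaqMidReflect e k σ p) = p := by
  obtain ⟨x, q⟩ := p
  by_cases hp : HasDir (x, q) k
  · have hp' : HasDir (plaqMidReflect e k σ (x, q)) k := hp
    ext1
    · rw [plaqMidReflect_fst_of_hasDir hp', plaqMidReflect_fst_of_hasDir hp]
      exact hF.invol x
    · rfl
  · have hp' : ¬ HasDir (plaqMidReflect e k σ (x, q)) k := hp
    ext1
    · rw [plaqMidReflect_fst_of_not_hasDir hp', plaqMidReflect_fst_of_not_hasDir hp]
      exact hF.midReflect_midReflect x
    · rfl

/-! ## Plaquette observables and the action -/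

section Holonomy

variable {N : ℕ} {G : Type*} [Group G] [TopologicalSpace G] [IsTopologicalGroup G] [CompactSpace G]
variable (ρ : G →* Matrix (Fin N) (Fin N) ℂ)

/-- **`∑_p c(plaqMidReflect p) f(Re tr ρ((Θ_mid U)_p)) = ∑_p c(p) f(Re tr ρ(U_p))`** — re-indexing a
weighted plaquette sum along the involution `plaqMidReflect`, through
`Re tr ρ((Θ_mid U)_p) = Re tr ρ(U_{plaqMidReflect p})` (see `plaqMidReflect_eq_plaqReflect_add`).
[folklore] -/
theorem sum_plaqMidReflect_configMidReflect [Fintype A] (hρ : Continuous ρ) (c : Plaq A d → ℝ)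
    (f : ℝ → ℝ) (U : Config A d G) :
    ∑ p : Plaq A d, c (plaqMidReflect e k σ p) * f (plaqObs ρ e p (configMidReflect e k σ U)) =
      ∑ p : Plaq A d, c p * f (plaqObs ρ e p U) := by
  have h1 : ∀ p : Plaq A d,
      plaqObs ρ e p (configMidReflect e k σ U) = plaqObs ρ e (plaqMidReflect e k σ p) U := fun p => by
    rw [configMidReflect_eq_configReflect_translate, hF.plaqObs_configReflect ρ hρ, plaqObs_translate,
      plaqMidReflect_eq_plaqReflect_add]
  simp_rw [h1]
  exact Fintype.sum_equiv (Function.Involutive.toPerm _ hF.plaqMidReflect_plaqMidReflect) _ _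
    fun _ => rfl

/-- **The Wilson action is invariant**: `S(Θ_mid U) = S(U)`. [folklore] -/
theorem wilsonAction_configMidReflect [Fintype A] (hρ : Continuous ρ) (U : Config A d G) :
    wilsonAction ρ e (configMidReflect e k σ U) = wilsonAction ρ e U := by
  rw [configMidReflect_eq_configReflect_translate, hF.wilsonAction_configReflect ρ hρ,
    wilsonAction_translate]

end Holonomy

/-! ## The measures -/

section Measure

variable [Fintype A] {N : ℕ} {G : Type*} [Group G] [TopologicalSpace G] [IsTopologicalGroup G]
  [CompactSpace G] [MeasurableSpace G] [BorelSpace G]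
variable (ρ : G →* Matrix (Fin N) (Fin N) ℂ)

variable [SecondCountableTopology G]

/-- **`Θ_mid`-invariance of the Wilson measure**: `∫ F(Θ_mid U) dμ_β = ∫ F dμ_β` for measurable
complex `F`, every real `β` — the mid-plane reflection of every axis flip is a SYMMETRY of `μ_β`
(translation invariance composed with `IsAxisFlip.integral_comp_configReflect_gibbs_complex`; whether
it is of positive type is a different question). [folklore] -/
theorem integral_comp_configMidReflect_gibbs_complex (hρ : Continuous ρ) (β : ℝ) {F : Config A d G → ℂ}
    (hFm : Measurable F) :
    ∫ U, F (configMidReflect e k σ U) ∂(gibbs ρ e β) = ∫ U, F U ∂(gibbs ρ e β) := by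
  simp_rw [configMidReflect_eq_configReflect_translate]
  rw [integral_comp_translate_gibbs_complex ρ hρ e β (e k) (F := fun U => F (configReflect e k σ U))
    (hFm.comp IsSiteFrame.measurable_configReflect)]
  exact hF.integral_comp_configReflect_gibbs_complex ρ hρ β hFm

end Measure

end IsAxisFlip

end TiltedRP

end Summit.QuantumFields.GaugeBoot

end
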